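import Mathlib
import Summits.CriticalPhenomena.PercolationContinuityZ3.Theorems.PercNearOneGluingNearOneGluingKnLemma3i
import HarnessLib

/-!
# `NoHeavyLowerTail` (stmt-CriticalPhenomena-4575), line fat-minority-linear — the SIGNED form of
# Kozma–Nitzan's Lemma 3(i)

Route task `nh-dp-fatminority` (gen 5).  `μ = prodBernoulli w` on the pairs of `Fin n`.

Kozma–Nitzan's Lemma 3(i) (tree: `knLemma3i`) transports a comparison `μ(a ↔ b) ≤ μ(c ↔ b) + d` through
conditioning on an increasing event `Q` determined by the open edge cluster of `c`, at the price of the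
slack `d ≥ 0`.  Its proof (BHK 2006 Thm 1.3 for `c`, Thm 1.4 for `a` versus `c`, with `D = {a ↮ c}`) in
fact gives the two-sided, SIGNED inequality

  `μ(D) · ( μ({a ↔ b} ∩ Q) − μ({c ↔ b} ∩ Q) ) ≤ μ(D ∩ Q) · ( μ(a ↔ b) − μ(c ↔ b) )`     (`signedLemma3i`),

valid whatever the sign of `μ(a ↔ b) − μ(c ↔ b)`: when `c` is MORE reliable than `a`, the advantage of `c`
survives the conditioning with the factor `μ(D ∩ Q)/μ(D) = μ(Q | a ↮ c)` (no loss of sign).  This is the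
tool behind the gen-5 reduction of linear gluing on the one-layer class (Kozma–Nitzan's Question 9 at
depth 2) to an ordering lemma on `G ∖ o` (`FINDINGS-fat-minority-gen5.md` §3): it lets the comparison
of the anchor with a reached relay be AVERAGED over rows of both signs.  No new definitions.
-/

namespace Summit.CriticalPhenomena.PercolationContinuityZ3.Theorems

open MeasureTheory Set
open Literature.Probability.LatticeModels (prodBernoulli)
open Literature.Probability.Percolation (BondConfig openConn openEdgeCluster)

noncomputable section
open Classical
open Literature.Probability.LatticeModels Literature.Probability.Percolation

variable {n : ℕ}

/-- **Signed Kozma–Nitzan Lemma 3(i).**  For vertices `a, c, b`, `D = {a ↮ c}` and an increasing event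
`Q` determined by the open edge cluster of `c`:
`μ(D) · (μ({a↔b} ∩ Q) − μ({c↔b} ∩ Q)) ≤ μ(D ∩ Q) · (μ(a↔b) − μ(c↔b))`.
Proof: off `D` the events `{a ↔ b}` and `{c ↔ b}` coincide; on `D`, BHK 2006 Thm 1.4 gives
`μ(D) μ(D ∩ {a↔b} ∩ Q) ≤ μ(D ∩ {a↔b}) μ(D ∩ Q)` and Thm 1.3 gives
`μ(D ∩ {c↔b}) μ(D ∩ Q) ≤ μ(D) μ(D ∩ {c↔b} ∩ Q)`; subtract.
[cite: KozmaNitzan2024, Lemma 3(i) p. 6; VandenbergHaggstromKahn2005, Thm. 1.3–1.4] -/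
theorem signedLemma3i (w : Sym2 (Fin n) → unitInterval) (a c b : Fin n)
    (Q : Set (BondConfig (Fin n)))
    (hQ : ∀ ω ω', ω ∈ Q → openEdgeCluster ω c ⊆ openEdgeCluster ω' c → ω' ∈ Q) :
    (prodBernoulli w).real (openConn a c)ᶜ *
        ((prodBernoulli w).real (openConn a b ∩ Q) - (prodBernoulli w).real (openConn c b ∩ Q)) ≤
      (prodBernoulli w).real ((openConn a c)ᶜ ∩ Q) *
        ((prodBernoulli w).real (openConn a b) - (prodBernoulli w).real (openConn c b)) := by
  set μ := prodBernoulli w with hμ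
  rcases eq_or_ne a c with hac | hac
  · subst hac
    have hD : ((openConn a a)ᶜ : Set (BondConfig (Fin n))) = ∅ := by
      ext ω
      simp only [Set.mem_compl_iff, Set.mem_empty_iff_false, iff_false, not_not]
      exact SimpleGraph.Reachable.refl _
    simp [hD]
  have hDm : MeasurableSet ((openConn a c)ᶜ : Set (BondConfig (Fin n))) :=
    MeasurableSet.of_discrete
  -- off `D` the two events agree
  have hagree : ∀ E : Set (BondConfig (Fin n)),
      (openConn a b ∩ E) \ (openConn a c)ᶜ = (openConn c b ∩ E) \ (openConn a c)ᶜ := by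
    intro E
    ext ω
    simp only [Set.mem_sdiff, Set.mem_inter_iff, Set.mem_compl_iff, not_not]
    constructor
    · rintro ⟨⟨h1, hE⟩, h2⟩
      exact ⟨⟨SimpleGraph.Reachable.trans (SimpleGraph.Reachable.symm h2) h1, hE⟩, h2⟩
    · rintro ⟨⟨h1, hE⟩, h2⟩
      exact ⟨⟨SimpleGraph.Reachable.trans h2 h1, hE⟩, h2⟩
  have hs1 := measureReal_inter_add_sdiff (μ := μ) (s := openConn a b) hDm
  have hs2 := measureReal_inter_add_sdiff (μ := μ) (s := openConn c b) hDm
  have hs1Q := measureReal_inter_add_sdiff (μ := μ) (s := openConn a b ∩ Q) hDm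
  have hs2Q := measureReal_inter_add_sdiff (μ := μ) (s := openConn c b ∩ Q) hDm
  have he : μ.real (openConn a b \ (openConn a c)ᶜ) = μ.real (openConn c b \ (openConn a c)ᶜ) := by
    have h := hagree Set.univ
    simp only [Set.inter_univ] at h
    rw [h]
  have heQ : μ.real ((openConn a b ∩ Q) \ (openConn a c)ᶜ) =
      μ.real ((openConn c b ∩ Q) \ (openConn a c)ᶜ) := by rw [hagree Q]
  rw [Set.inter_comm (openConn a b) (openConn a c)ᶜ] at hs1
  rw [Set.inter_comm (openConn c b) (openConn a c)ᶜ] at hs2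
  rw [Set.inter_comm (openConn a b ∩ Q) (openConn a c)ᶜ] at hs1Q
  rw [Set.inter_comm (openConn c b ∩ Q) (openConn a c)ᶜ] at hs2Q
  -- BHK Thm 1.3 at `c` (with `X = {a}`) and Thm 1.4 for `a` versus `c`
  have hI := knLemma3i_oneCluster w c a b Q hQ hac.symm
  have hcomm : (openConn c a : Set (BondConfig (Fin n))) = openConn a c :=
    Set.ext fun _ => ⟨fun h => SimpleGraph.Reachable.symm h, fun h => SimpleGraph.Reachable.symm h⟩
  rw [hcomm] at hI
  have hII := knLemma3i_twoCluster w a c b Q hQ hac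
  -- the `D`-parts: `x_i = μ(D ∩ {· ↔ b})`, `y_i = μ(D ∩ {· ↔ b} ∩ Q)`, `q = μ(D ∩ Q)`, `m = μ(D)`
  -- `m y₁ ≤ x₁ q` (hII) and `x₂ q ≤ m y₂` (hI); the off-`D` parts cancel in both differences.
  have key : μ.real (openConn a c)ᶜ *
        (μ.real ((openConn a c)ᶜ ∩ (openConn a b ∩ Q)) -
          μ.real ((openConn a c)ᶜ ∩ (openConn c b ∩ Q))) ≤
      μ.real ((openConn a c)ᶜ ∩ Q) *
        (μ.real ((openConn a c)ᶜ ∩ openConn a b) - μ.real ((openConn a c)ᶜ ∩ openConn c b)) := by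
    have h1 : μ.real (openConn a c)ᶜ * μ.real ((openConn a c)ᶜ ∩ (openConn a b ∩ Q)) ≤
        μ.real ((openConn a c)ᶜ ∩ openConn a b) * μ.real ((openConn a c)ᶜ ∩ Q) := hII
    have h2 : μ.real ((openConn a c)ᶜ ∩ openConn c b) * μ.real ((openConn a c)ᶜ ∩ Q) ≤
        μ.real (openConn a c)ᶜ * μ.real ((openConn a c)ᶜ ∩ (openConn c b ∩ Q)) := hI
    nlinarith [h1, h2]
  have hdiffQ : μ.real (openConn a b ∩ Q) - μ.real (openConn c b ∩ Q) =
      μ.real ((openConn a c)ᶜ ∩ (openConn a b ∩ Q)) -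
        μ.real ((openConn a c)ᶜ ∩ (openConn c b ∩ Q)) := by linarith
  have hdiff : μ.real (openConn a b) - μ.real (openConn c b) =
      μ.real ((openConn a c)ᶜ ∩ openConn a b) - μ.real ((openConn a c)ᶜ ∩ openConn c b) := by
    linarith
  rw [hdiffQ, hdiff]
  exact key

/-- **Signed Lemma 3(i), consequence.**  If `c` is at least as reliable as `a` (`μ(a↔b) ≤ μ(c↔b)`)
then for every increasing `Q` determined by the open edge cluster of `c`,
`μ({a↔b} ∩ Q) ≤ μ({c↔b} ∩ Q)`, provided `μ(a ↮ c) > 0`. (The case `d = 0` of `knLemma3i`, re-derived.)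
[cite: KozmaNitzan2024, Lemma 3(i) p. 6] -/
theorem signedLemma3i_of_le (w : Sym2 (Fin n) → unitInterval) (a c b : Fin n)
    (Q : Set (BondConfig (Fin n)))
    (hQ : ∀ ω ω', ω ∈ Q → openEdgeCluster ω c ⊆ openEdgeCluster ω' c → ω' ∈ Q)
    (hle : (prodBernoulli w).real (openConn a b) ≤ (prodBernoulli w).real (openConn c b))
    (hD : 0 < (prodBernoulli w).real (openConn a c)ᶜ) :
    (prodBernoulli w).real (openConn a b ∩ Q) ≤ (prodBernoulli w).real (openConn c b ∩ Q) := by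
  have h := signedLemma3i w a c b Q hQ
  have hq : 0 ≤ (prodBernoulli w).real ((openConn a c)ᶜ ∩ Q) := measureReal_nonneg
  have hrhs : (prodBernoulli w).real ((openConn a c)ᶜ ∩ Q) *
      ((prodBernoulli w).real (openConn a b) - (prodBernoulli w).real (openConn c b)) ≤ 0 :=
    mul_nonpos_of_nonneg_of_nonpos hq (by linarith)
  nlinarith [h, hrhs, hD]

end

end Summit.CriticalPhenomena.PercolationContinuityZ3.Theorems
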